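import Literature.NumberTheory.Automorphic.GLnTwoBlockUnipotentHaarTransport
import HarnessLib

/-!
# The orbital integral of `GL_n(F)` at an `M`-central `(G, M)`-regular point, in Iwasawa coordinates:
# `∫_{G ⧸ M_c} f(y z y⁻¹) = C ‖det(1 - K_z)‖⁻¹ ∫_{K × U_c} f(k (u z) k⁻¹) = C ‖det(1 - K_z)‖⁻¹ ‖det K_z‖ ∫_{K × U_c} f(k (z u) k⁻¹)`

Topic `NumberTheory/Automorphic`; namespace `Literature.NumberTheory.Automorphic`. KERNEL
mathematics only: theorems, no definition, no named fact, no instance, no `sorry`. Road «D-S1»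
(parabolic descent of orbital integrals, Rogawski 1990, Lemma 4.13.1 and its proof p. 70) for
`G = GL_n(F)`, `F` a non-archimedean local field, a monotone TWO-block labelling `c : Fin n → Bool`
(`P_c = M_c U_c ⊇ B`), `K = GL_n(𝒪)`. Assembly of
`GLnLeviQuotientIwasawaIntegration` (`∫_{G ⧸ M_c} f(y γ y⁻¹) dμ = C ∫_{K × U_c} f((k u) γ (k u)⁻¹)`) with
`GLnTwoBlockUnipotentHaarTransport` (the twisted commutator `u p u⁻¹ = T(u) p`, module
`‖det(1 - K_p)‖_F`, and `Ad(p)`, module `‖det K_p‖_F`, on `U_c(F)` at the measure level); no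
integrability or Fubini hypothesis anywhere. `A` is a free subgroup with `hA : A = standardLeviGL F c`,
so that a consumer may take `A = C_G(z)` via `centralizer_blockDiagonalGL_scalar_eq_standardLeviGL`.

* §1 `exists_integral_descConj_levi_eq_smul_unipotent_mul` — ONE constant `C ≠ 0` (depending on
  `μ, κ, μ_U` only) with **`∫_{G ⧸ A} f(y p y⁻¹) dμ(y) = C ‖det(1 - K_p)‖_F⁻¹ ∫_{K × U_c} f(k (u p) k⁻¹)`**
  for every continuous `f` and every `p ∈ P_c(F)` centralised by `A = M_c` with `det(1 - K_p) ≠ 0`;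
  `exists_integral_descConj_levi_eq_smul_parabolic_mul_unipotent` — the constant-term shape
  **`… = C ‖det(1 - K_p)‖_F⁻¹ ‖det K_p‖_F ∫_{K × U_c} f(k (p u) k⁻¹)`**.
* §2 `boxAd_leviEmbeddingP_scalar` — for the block scalar `z = diag(t₁ 1_I, t₂ 1_J)`:
  `K_z = (t₁/t₂) · 1` (any commutative ring); `exists_integral_descConj_blockScalar_eq_smul`,
  `exists_integral_descConj_blockScalar_eq_smul'` — for `t₁ ≠ t₂` (`A = C_G(z) = M_c`):
  **`∫_{G ⧸ A} f(y z y⁻¹) dμ = C ‖1 - t₁/t₂‖_F^{-|I||J|} ∫_{K × U_c} f(k (u z) k⁻¹)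
  = C ‖t₂/t₁ - 1‖_F^{-|I||J|} ∫_{K × U_c} f(k (z u) k⁻¹)`** — for `GL_3 ⊃ P_{(2,1)}`, `z = diag(e₁, e₁, e₂)`:
  Rogawski's `Φ(γ, f)` at the singular `(G, H)`-regular element of §4.13 / Prop. 8.2.1 (split place),
  `|(1 - γ₂γ₁⁻¹)(1 - γ₂γ₃⁻¹)|`-normalised as on p. 70.

Dictionary for the regular descent D-S1c (read against the split transfer factor of
`Rogawski1990/FinExplicitTransferFactorSplitPlace`, `finWeylRatio_eq_box_of_split`:
`D(p) = ‖det(1 - K_p)‖ · ‖det K_p‖^{-1/2} = |D_{G/M}(p)|^{1/2}`): the constant of §1 is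
`‖det(1 - K_p)‖⁻¹ · ‖det K_p‖ = D(p)⁻¹ · ‖det K_p‖^{1/2} = |D_{G/M}(p)|^{-1/2} δ_P(p)^{1/2}` with
`δ_P(p) = ‖det K_p‖` the modulus of `Ad(p)` on `U_c` (`exists_homeomorph_unipotentRadicalGL_parabolic_conj`).

## References

* [Rogawski1990] J. D. Rogawski, *Automorphic Representations of Unitary Groups in Three Variables*,
  Ann. of Math. Stud. 123 (1990), §4.13, Lemma 4.13.1 and proof p. 70; Prop. 8.2.1 p. 117.
* [Gelbart1975] S. Gelbart, *Automorphic forms on adele groups* (1975), Thm. 9.22 (iii), Remark 9.23.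
-/

noncomputable section

open scoped MatrixGroups NNReal ENNReal
open MeasureTheory Measure Matrix Topology

namespace Literature.NumberTheory.Automorphic

open Literature.MeasureTheory.Group
open Literature.NumberTheory.GaloisRepresentations.IsNonarchimedeanLocalField

/-! ### 1. The orbital integrand at a point of `P_c` centralised by `M_c` -/

section Descent

variable (F : Type*) [Field F] [ValuativeRel F] [TopologicalSpace F] [IsNonarchimedeanLocalField F]
  [MeasurableSpace F] [BorelSpace F]
  {n : ℕ} {c : Fin n → Bool} [MeasurableSpace (GL (Fin n) F)] [BorelSpace (GL (Fin n) F)]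
  {E : Type*} [NormedAddCommGroup E] [NormedSpace ℝ E]

/-- **Descent of the orbital integrand to `K × U_c` with the unipotent substitution made**
(Rogawski 1990, proof of Lemma 4.13.1, p. 70): for a monotone two-block labelling `c`, `A = M_c`
(`hA`; e.g. `A = C_G(z)` by `centralizer_blockDiagonalGL_scalar_eq_standardLeviGL`), a non-zero
invariant measure `μ` on `G ⧸ A` finite on compacts and Haar measures `κ` on `K = GL_n(𝒪)`, `μ_U` on
`U_c`, there is ONE constant `C ≠ 0` such that for every `p ∈ P_c(F)` centralised by `A` with
`det(1 - K_p) ≠ 0` and every continuous `f`: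
**`∫_{G ⧸ A} f(y p y⁻¹) dμ(y) = (C ‖det(1 - K_p)‖_F⁻¹) · ∫_{K × U_c} f(k (u p) k⁻¹) d(κ ⊗ μ_U)`.**
[cite: Rogawski1990, §4.13, proof of Lemma 4.13.1, p. 70] -/
theorem exists_integral_descConj_levi_eq_smul_unipotent_mul (hc : Monotone c)
    {A : Subgroup (GL (Fin n) F)} (hA : A = standardLeviGL F c)
    [MeasurableSpace (GL (Fin n) F ⧸ A)] [BorelSpace (GL (Fin n) F ⧸ A)]
    (μ : Measure (GL (Fin n) F ⧸ A)) [SMulInvariantMeasure (GL (Fin n) F) (GL (Fin n) F ⧸ A) μ]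
    [IsFiniteMeasureOnCompacts μ] (hμ : μ ≠ 0)
    (κ : Measure ↥(glInt n F)) [IsHaarMeasure κ]
    (μN : Measure ↥(unipotentRadicalGL F c)) [IsHaarMeasure μN] :
    ∃ C : ℝ≥0, C ≠ 0 ∧ ∀ (p : standardParabolicGL F c)
      (hpA : ∀ a ∈ A, a * (p : GL (Fin n) F) = (p : GL (Fin n) F) * a)
      (_hp : (1 - Matrix.of fun q q' : {i : Fin n // c i = false} × {j : Fin n // c j = true} =>
          ((p : GL (Fin n) F) : Matrix (Fin n) (Fin n) F) q.1 q'.1 *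
            (((p⁻¹ : standardParabolicGL F c) : GL (Fin n) F) : Matrix (Fin n) (Fin n) F) q'.2 q.2).det
          ≠ 0)
      (f : GL (Fin n) F → E), Continuous f →
        ∫ y, descConj (p : GL (Fin n) F) A hpA f y ∂μ =
          ((C * normAbs F ((1 - Matrix.of
              fun q q' : {i : Fin n // c i = false} × {j : Fin n // c j = true} =>
                ((p : GL (Fin n) F) : Matrix (Fin n) (Fin n) F) q.1 q'.1 *
                  (((p⁻¹ : standardParabolicGL F c) : GL (Fin n) F) : Matrix (Fin n) (Fin n) F)
                    q'.2 q.2).det)⁻¹ : ℝ≥0) : ℝ) •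
            ∫ q : ↥(glInt n F) × ↥(unipotentRadicalGL F c),
              f ((q.1 : GL (Fin n) F) * ((q.2 : GL (Fin n) F) * (p : GL (Fin n) F)) *
                (q.1 : GL (Fin n) F)⁻¹) ∂(κ.prod μN) := by
  haveI : T2Space F := (isLocalField F).toT2Space
  haveI : BorelSpace ↥(unipotentRadicalGL F c) := Subtype.borelSpace _
  haveI : BorelSpace ↥(glInt n F) := Subtype.borelSpace _
  haveI : CompactSpace ↥(glInt n F) := isCompact_iff_compactSpace.1 (isCompact_glInt n F)
  haveI : IsFiniteMeasure κ := CompactSpace.isFiniteMeasure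
  obtain ⟨C, hC, h⟩ := exists_integral_descConj_levi_eq_smul_bool F hc hA μ hμ κ μN (E := E)
  refine ⟨C, hC, fun p hpA hp f hf => ?_⟩
  rw [h (p : GL (Fin n) F) hpA f hf,
    integral_prod_unipotent_conj_eq_smul κ (fun k : ↥(glInt n F) => (k : GL (Fin n) F)) μN p hp f,
    NNReal.smul_def, smul_smul, ← NNReal.coe_mul]

/-- **The same in the constant-term shape `f(k (p u) k⁻¹)`**: with the SAME constant `C`,
**`∫_{G ⧸ A} f(y p y⁻¹) dμ(y) = (C ‖det(1 - K_p)‖_F⁻¹ ‖det K_p‖_F) · ∫_{K × U_c} f(k (p u) k⁻¹) d(κ ⊗ μ_U)`**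
(`integral_prod_unipotent_mul_parabolic_eq_smul`: `‖det K_p‖_F` is the modulus `δ_P(p)` on `U_c`);
for `p = γ ∈ M` this is `C · |D_{G/M}(γ)|^{-1/2} δ_P(γ)^{1/2} ∫_K ∫_{U} f(k γ u k⁻¹)`, i.e. Rogawski's
normalisation `f̄^P(m) = δ_P(m)^{1/2} ∫_K ∫_U f(k m u k⁻¹)` of the constant term
(`|D_{G/M}(γ)| = ‖det(1 - K_γ)‖² ‖det K_γ‖⁻¹`). [cite: Rogawski1990, §4.13, proof of Lemma 4.13.1, p. 70] -/
theorem exists_integral_descConj_levi_eq_smul_parabolic_mul_unipotent (hc : Monotone c)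
    {A : Subgroup (GL (Fin n) F)} (hA : A = standardLeviGL F c)
    [MeasurableSpace (GL (Fin n) F ⧸ A)] [BorelSpace (GL (Fin n) F ⧸ A)]
    (μ : Measure (GL (Fin n) F ⧸ A)) [SMulInvariantMeasure (GL (Fin n) F) (GL (Fin n) F ⧸ A) μ]
    [IsFiniteMeasureOnCompacts μ] (hμ : μ ≠ 0)
    (κ : Measure ↥(glInt n F)) [IsHaarMeasure κ]
    (μN : Measure ↥(unipotentRadicalGL F c)) [IsHaarMeasure μN] :
    ∃ C : ℝ≥0, C ≠ 0 ∧ ∀ (p : standardParabolicGL F c)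
      (hpA : ∀ a ∈ A, a * (p : GL (Fin n) F) = (p : GL (Fin n) F) * a)
      (_hp : (1 - Matrix.of fun q q' : {i : Fin n // c i = false} × {j : Fin n // c j = true} =>
          ((p : GL (Fin n) F) : Matrix (Fin n) (Fin n) F) q.1 q'.1 *
            (((p⁻¹ : standardParabolicGL F c) : GL (Fin n) F) : Matrix (Fin n) (Fin n) F) q'.2 q.2).det
          ≠ 0)
      (f : GL (Fin n) F → E), Continuous f →
        ∫ y, descConj (p : GL (Fin n) F) A hpA f y ∂μ =
          ((C * normAbs F ((1 - Matrix.of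
              fun q q' : {i : Fin n // c i = false} × {j : Fin n // c j = true} =>
                ((p : GL (Fin n) F) : Matrix (Fin n) (Fin n) F) q.1 q'.1 *
                  (((p⁻¹ : standardParabolicGL F c) : GL (Fin n) F) : Matrix (Fin n) (Fin n) F)
                    q'.2 q.2).det)⁻¹ *
            normAbs F (Matrix.of
              fun q q' : {i : Fin n // c i = false} × {j : Fin n // c j = true} =>
                ((p : GL (Fin n) F) : Matrix (Fin n) (Fin n) F) q.1 q'.1 *
                  (((p⁻¹ : standardParabolicGL F c) : GL (Fin n) F) : Matrix (Fin n) (Fin n) F)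
                    q'.2 q.2).det : ℝ≥0) : ℝ) •
            ∫ q : ↥(glInt n F) × ↥(unipotentRadicalGL F c),
              f ((q.1 : GL (Fin n) F) * ((p : GL (Fin n) F) * (q.2 : GL (Fin n) F)) *
                (q.1 : GL (Fin n) F)⁻¹) ∂(κ.prod μN) := by
  haveI : T2Space F := (isLocalField F).toT2Space
  haveI : BorelSpace ↥(unipotentRadicalGL F c) := Subtype.borelSpace _
  haveI : BorelSpace ↥(glInt n F) := Subtype.borelSpace _
  haveI : CompactSpace ↥(glInt n F) := isCompact_iff_compactSpace.1 (isCompact_glInt n F)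
  haveI : IsFiniteMeasure κ := CompactSpace.isFiniteMeasure
  obtain ⟨C, hC, h⟩ := exists_integral_descConj_levi_eq_smul_unipotent_mul F hc hA μ hμ κ μN (E := E)
  refine ⟨C, hC, fun p hpA hp f hf => ?_⟩
  rw [h p hpA hp f hf,
    integral_prod_unipotent_mul_parabolic_eq_smul κ (fun k : ↥(glInt n F) => (k : GL (Fin n) F)) μN p f,
    smul_smul, ← NNReal.coe_mul]

end Descent

/-! ### 2. The regular block scalar `z = diag(t₁ · 1_I, t₂ · 1_J)` -/

section BlockScalar

variable {R : Type*} [CommRing R] {m : Type*} [Fintype m] [DecidableEq m] (c : m → Bool)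

/-- **`K_z = (t₁/t₂) · 1`** for the block scalar `z = diag(t₁ · 1_I, t₂ · 1_J) ∈ P_c(R)`
(`leviEmbeddingP R c (t_a · 1)_a`): the adjoint action of `z` on the box is the homothety `t₁ t₂⁻¹`
(so `det K_z = (t₁/t₂)^{|I||J|}`, `det(1 - K_z) = (1 - t₁/t₂)^{|I||J|}`). [cite: Rogawski1990, §4.13, proof of Lemma 4.13.1, p. 70] -/
theorem boxAd_leviEmbeddingP_scalar (t : Bool → Rˣ) :
    (Matrix.of fun q q' : {i : m // c i = false} × {j : m // c j = true} =>
      (((leviEmbeddingP R c fun a => Matrix.GeneralLinearGroup.scalar _ (t a) :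
          standardParabolicGL R c) : GL m R) : Matrix m m R) q.1 q'.1 *
        ((((leviEmbeddingP R c fun a => Matrix.GeneralLinearGroup.scalar _ (t a))⁻¹ :
            standardParabolicGL R c) : GL m R) : Matrix m m R) q'.2 q.2) =
      ((t false : R) * ((t true)⁻¹ : Rˣ)) • (1 : Matrix _ _ R) := by
  classical
  have hcoe : ((leviEmbeddingP R c fun a => Matrix.GeneralLinearGroup.scalar _ (t a) :
      standardParabolicGL R c) : GL m R) =
      blockDiagonalGL R c (fun a => Matrix.GeneralLinearGroup.scalar _ (t a)) := rfl
  have hinv : (((leviEmbeddingP R c fun a => Matrix.GeneralLinearGroup.scalar _ (t a))⁻¹ :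
      standardParabolicGL R c) : GL m R) =
      blockDiagonalGL R c (fun a => Matrix.GeneralLinearGroup.scalar _ (t a)⁻¹) :=
    calc (((leviEmbeddingP R c fun a => Matrix.GeneralLinearGroup.scalar _ (t a))⁻¹ :
          standardParabolicGL R c) : GL m R)
        = (blockDiagonalGL R c (fun a => Matrix.GeneralLinearGroup.scalar _ (t a)))⁻¹ := by
          rw [Subgroup.coe_inv, hcoe]
      _ = blockDiagonalGL R c (fun a => Matrix.GeneralLinearGroup.scalar _ (t a))⁻¹ :=
          (map_inv _ _).symm
      _ = blockDiagonalGL R c (fun a => Matrix.GeneralLinearGroup.scalar _ (t a)⁻¹) := by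
          congr 1
  ext q q'
  rw [Matrix.of_apply, hcoe, hinv, coe_blockDiagonalGL_scalar, coe_blockDiagonalGL_scalar,
    Matrix.diagonal_apply, Matrix.diagonal_apply, Matrix.smul_apply, Matrix.one_apply, q.1.2, q'.2.2]
  by_cases hqq : q = q'
  · subst hqq
    simp
  · have : ¬ ((q.1 : m) = q'.1 ∧ (q'.2 : m) = q.2) := by
      rintro ⟨h1, h2⟩
      exact hqq (Prod.ext (Subtype.ext h1) (Subtype.ext h2.symm))
    rw [if_neg hqq, smul_eq_mul, mul_zero]
    by_cases h1 : (q.1 : m) = q'.1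
    · rw [if_pos h1, if_neg (fun h2 => this ⟨h1, h2⟩), mul_zero]
    · rw [if_neg h1, zero_mul]

variable (F : Type*) [Field F] [ValuativeRel F] [TopologicalSpace F] [IsNonarchimedeanLocalField F]
  [MeasurableSpace F] [BorelSpace F]
  {n : ℕ} {c : Fin n → Bool} [MeasurableSpace (GL (Fin n) F)] [BorelSpace (GL (Fin n) F)]
  {E : Type*} [NormedAddCommGroup E] [NormedSpace ℝ E]

/-- **The orbital integrand at a regular block scalar** `z = diag(t₁ · 1_I, t₂ · 1_J) ∈ GL_n(F)`,
`t₁ ≠ t₂` (so `C_G(z) = M_c`, `centralizer_blockDiagonalGL_scalar_eq_standardLeviGL`; `z` is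
`M`-central and `(G, M)`-regular: `K_z = (t₁/t₂) · 1`, `det(1 - K_z) = (1 - t₁/t₂)^{|I| |J|} ≠ 0`): for
`A = M_c`, every non-zero invariant Radon measure `μ` on `G ⧸ A` and Haar measures `κ`, `μ_U` there is
ONE `C ≠ 0` (that of `exists_integral_descConj_levi_eq_smul_unipotent_mul`, the same for all `t`) with
**`∫_{G ⧸ A} f(y z y⁻¹) dμ(y) = C ‖1 - t₁/t₂‖_F^{-|I||J|} ∫_{K × U_c} f(k (u z) k⁻¹) d(κ ⊗ μ_U)`** for every
continuous `f`. For `n = 3`, `c = (2, 1)`, `z = diag(e₁, e₁, e₂)` the left side is Rogawski's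
`Φ(γ, f)` at the singular `(G, H)`-regular element of §4.13 / Prop. 8.2.1 at a split place.
[cite: Rogawski1990, §4.13, proof of Lemma 4.13.1, p. 70] -/
theorem exists_integral_descConj_blockScalar_eq_smul (hc : Monotone c)
    {A : Subgroup (GL (Fin n) F)} (hA : A = standardLeviGL F c)
    [MeasurableSpace (GL (Fin n) F ⧸ A)] [BorelSpace (GL (Fin n) F ⧸ A)]
    (μ : Measure (GL (Fin n) F ⧸ A)) [SMulInvariantMeasure (GL (Fin n) F) (GL (Fin n) F ⧸ A) μ]
    [IsFiniteMeasureOnCompacts μ] (hμ : μ ≠ 0)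
    (κ : Measure ↥(glInt n F)) [IsHaarMeasure κ]
    (μN : Measure ↥(unipotentRadicalGL F c)) [IsHaarMeasure μN] :
    ∃ C : ℝ≥0, C ≠ 0 ∧ ∀ (t : Bool → Fˣ) (_ht : (t false : F) ≠ t true)
      (hzA : ∀ a ∈ A, a * blockDiagonalGL F c (fun a => Matrix.GeneralLinearGroup.scalar _ (t a)) =
        blockDiagonalGL F c (fun a => Matrix.GeneralLinearGroup.scalar _ (t a)) * a)
      (f : GL (Fin n) F → E), Continuous f →
        ∫ y, descConj (blockDiagonalGL F c fun a => Matrix.GeneralLinearGroup.scalar _ (t a)) A hzA f y ∂μ =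
          ((C * normAbs F ((1 - (t false : F) * (t true : F)⁻¹) ^
              (Fintype.card {i : Fin n // c i = false} * Fintype.card {j : Fin n // c j = true}))⁻¹ :
              ℝ≥0) : ℝ) •
            ∫ q : ↥(glInt n F) × ↥(unipotentRadicalGL F c),
              f ((q.1 : GL (Fin n) F) *
                ((q.2 : GL (Fin n) F) * blockDiagonalGL F c (fun a => Matrix.GeneralLinearGroup.scalar _ (t a))) *
                (q.1 : GL (Fin n) F)⁻¹) ∂(κ.prod μN) := by
  classical
  obtain ⟨C, hC, h⟩ := exists_integral_descConj_levi_eq_smul_unipotent_mul F hc hA μ hμ κ μN (E := E)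
  refine ⟨C, hC, fun t ht hzA f hf => ?_⟩
  have hK := boxAd_leviEmbeddingP_scalar (R := F) c t
  rw [Units.val_inv_eq_inv_val] at hK
  set z : standardParabolicGL F c :=
    leviEmbeddingP F c (fun a => Matrix.GeneralLinearGroup.scalar _ (t a)) with hz
  have hzcoe : (z : GL (Fin n) F) =
      blockDiagonalGL F c (fun a => Matrix.GeneralLinearGroup.scalar _ (t a)) := rfl
  have hdetK : (1 - Matrix.of fun q q' : {i : Fin n // c i = false} × {j : Fin n // c j = true} =>
      ((z : GL (Fin n) F) : Matrix (Fin n) (Fin n) F) q.1 q'.1 *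
        (((z⁻¹ : standardParabolicGL F c) : GL (Fin n) F) : Matrix (Fin n) (Fin n) F) q'.2 q.2).det =
      (1 - (t false : F) * (t true : F)⁻¹) ^
        (Fintype.card {i : Fin n // c i = false} * Fintype.card {j : Fin n // c j = true}) := by
    rw [hK, show (1 : Matrix ({i : Fin n // c i = false} × {j : Fin n // c j = true})
        ({i : Fin n // c i = false} × {j : Fin n // c j = true}) F) -
        ((t false : F) * (t true : F)⁻¹) • (1 : Matrix _ _ F) =
        (1 - (t false : F) * (t true : F)⁻¹) • (1 : Matrix _ _ F) by rw [sub_smul, one_smul],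
      Matrix.det_smul, Matrix.det_one, mul_one, Fintype.card_prod]
  have hne : (1 - Matrix.of fun q q' : {i : Fin n // c i = false} × {j : Fin n // c j = true} =>
      ((z : GL (Fin n) F) : Matrix (Fin n) (Fin n) F) q.1 q'.1 *
        (((z⁻¹ : standardParabolicGL F c) : GL (Fin n) F) : Matrix (Fin n) (Fin n) F) q'.2 q.2).det
        ≠ 0 := by
    rw [hdetK]
    refine pow_ne_zero _ (sub_ne_zero.2 fun h1 => ht ?_)
    have := congrArg (fun x : F => x * (t true : F)) h1
    simpa [mul_assoc] using this.symm
  have hmain := h z (by rw [hzcoe]; exact hzA) hne f hf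
  rw [hdetK] at hmain
  exact hmain

/-- **The same in the constant-term shape `f(k (z u) k⁻¹)`**: with the SAME constant `C`,
**`∫_{G ⧸ A} f(y z y⁻¹) dμ(y) = C ‖t₂/t₁ - 1‖_F^{-|I||J|} ∫_{K × U_c} f(k (z u) k⁻¹) d(κ ⊗ μ_U)`**
(`‖det(1 - K_z)‖⁻¹ ‖det K_z‖ = ‖((1 - t₁/t₂) t₂/t₁)^{|I||J|}‖⁻¹`). For `GL_3 ⊃ P_{(2,1)}`, `z = diag(e₁, e₁, e₂)`:
`Φ(z, f) = C |e₂/e₁ - 1|⁻² ∫_K ∫_U f(k z u k⁻¹) du dk`, a multiple of the constant term `f̄^P(z)`.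
[cite: Rogawski1990, §4.13, proof of Lemma 4.13.1, p. 70] -/
theorem exists_integral_descConj_blockScalar_eq_smul' (hc : Monotone c)
    {A : Subgroup (GL (Fin n) F)} (hA : A = standardLeviGL F c)
    [MeasurableSpace (GL (Fin n) F ⧸ A)] [BorelSpace (GL (Fin n) F ⧸ A)]
    (μ : Measure (GL (Fin n) F ⧸ A)) [SMulInvariantMeasure (GL (Fin n) F) (GL (Fin n) F ⧸ A) μ]
    [IsFiniteMeasureOnCompacts μ] (hμ : μ ≠ 0)
    (κ : Measure ↥(glInt n F)) [IsHaarMeasure κ]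
    (μN : Measure ↥(unipotentRadicalGL F c)) [IsHaarMeasure μN] :
    ∃ C : ℝ≥0, C ≠ 0 ∧ ∀ (t : Bool → Fˣ) (_ht : (t false : F) ≠ t true)
      (hzA : ∀ a ∈ A, a * blockDiagonalGL F c (fun a => Matrix.GeneralLinearGroup.scalar _ (t a)) =
        blockDiagonalGL F c (fun a => Matrix.GeneralLinearGroup.scalar _ (t a)) * a)
      (f : GL (Fin n) F → E), Continuous f →
        ∫ y, descConj (blockDiagonalGL F c fun a => Matrix.GeneralLinearGroup.scalar _ (t a)) A hzA f y ∂μ =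
          ((C * normAbs F (((t true : F) * (t false : F)⁻¹ - 1) ^
              (Fintype.card {i : Fin n // c i = false} * Fintype.card {j : Fin n // c j = true}))⁻¹ :
              ℝ≥0) : ℝ) •
            ∫ q : ↥(glInt n F) × ↥(unipotentRadicalGL F c),
              f ((q.1 : GL (Fin n) F) *
                (blockDiagonalGL F c (fun a => Matrix.GeneralLinearGroup.scalar _ (t a)) * (q.2 : GL (Fin n) F)) *
                (q.1 : GL (Fin n) F)⁻¹) ∂(κ.prod μN) := by
  classical
  obtain ⟨C, hC, h⟩ :=
    exists_integral_descConj_levi_eq_smul_parabolic_mul_unipotent F hc hA μ hμ κ μN (E := E)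
  refine ⟨C, hC, fun t ht hzA f hf => ?_⟩
  have hK := boxAd_leviEmbeddingP_scalar (R := F) c t
  rw [Units.val_inv_eq_inv_val] at hK
  set z : standardParabolicGL F c :=
    leviEmbeddingP F c (fun a => Matrix.GeneralLinearGroup.scalar _ (t a)) with hz
  have hzcoe : (z : GL (Fin n) F) =
      blockDiagonalGL F c (fun a => Matrix.GeneralLinearGroup.scalar _ (t a)) := rfl
  set a : F := (t false : F) * (t true : F)⁻¹ with ha
  set N : ℕ := Fintype.card {i : Fin n // c i = false} * Fintype.card {j : Fin n // c j = true} with hN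
  clear_value a
  have ha0 : a ≠ 0 := by
    rw [ha]; exact mul_ne_zero (Units.ne_zero _) (inv_ne_zero (Units.ne_zero _))
  have ha1 : 1 - a ≠ 0 := by
    refine sub_ne_zero.2 fun h1 => ht ?_
    rw [ha] at h1
    have := congrArg (fun x : F => x * (t true : F)) h1
    simpa [mul_assoc] using this.symm
  have hdetK : (Matrix.of fun q q' : {i : Fin n // c i = false} × {j : Fin n // c j = true} =>
      ((z : GL (Fin n) F) : Matrix (Fin n) (Fin n) F) q.1 q'.1 *
        (((z⁻¹ : standardParabolicGL F c) : GL (Fin n) F) : Matrix (Fin n) (Fin n) F) q'.2 q.2).det =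
      a ^ N := by
    rw [hK, Matrix.det_smul, Matrix.det_one, mul_one, Fintype.card_prod]
  have hdet1K : (1 - Matrix.of fun q q' : {i : Fin n // c i = false} × {j : Fin n // c j = true} =>
      ((z : GL (Fin n) F) : Matrix (Fin n) (Fin n) F) q.1 q'.1 *
        (((z⁻¹ : standardParabolicGL F c) : GL (Fin n) F) : Matrix (Fin n) (Fin n) F) q'.2 q.2).det =
      (1 - a) ^ N := by
    rw [hK, show (1 : Matrix ({i : Fin n // c i = false} × {j : Fin n // c j = true})
        ({i : Fin n // c i = false} × {j : Fin n // c j = true}) F) - a • (1 : Matrix _ _ F) =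
        (1 - a) • (1 : Matrix _ _ F) by rw [sub_smul, one_smul],
      Matrix.det_smul, Matrix.det_one, mul_one, Fintype.card_prod]
  have hne : (1 - Matrix.of fun q q' : {i : Fin n // c i = false} × {j : Fin n // c j = true} =>
      ((z : GL (Fin n) F) : Matrix (Fin n) (Fin n) F) q.1 q'.1 *
        (((z⁻¹ : standardParabolicGL F c) : GL (Fin n) F) : Matrix (Fin n) (Fin n) F) q'.2 q.2).det
        ≠ 0 := by
    rw [hdet1K]; exact pow_ne_zero _ ha1
  have hF : ((1 - a) ^ N)⁻¹ * a ^ N = (((t true : F) * (t false : F)⁻¹ - 1) ^ N)⁻¹ := by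
    have hinv : (t true : F) * (t false : F)⁻¹ = a⁻¹ := by rw [ha, mul_inv, inv_inv, mul_comm]
    rw [hinv, show a⁻¹ - 1 = (1 - a) * a⁻¹ by rw [sub_mul, one_mul, mul_inv_cancel₀ ha0], mul_pow,
      mul_inv, inv_pow, inv_inv]
  have hmain := h z (by rw [hzcoe]; exact hzA) hne f hf
  rw [hdetK, hdet1K, mul_assoc, ← map_mul, hF] at hmain
  exact hmain

end BlockScalar

end Literature.NumberTheory.Automorphic
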